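import Summits.QuantumAdvantage.AdviceFreeQNC0.AffBells22WalkHardAllSubcube
import Summits.QuantumAdvantage.AdviceFreeQNC0.WindowLocalHard
import HarnessLib

/-!
# OddPrimeWalkPinDialA — the PINNED square-root tube law, its floor, and the two dials it prices (decomp-qadv lens-1 g20, part A)

Field-free laws for α's u-walk game `ringWinU` (no `Theses` import; part B puts the dial on item 23109):

* `sum_card_merge` — double counting over the assignments of a pinned set (swap bijection of the double cube);
* **`pinLaw`** — if some coordinate set `W` with `n − |W| ≥ m₀` free coordinates is such that, under EVERY assignment of
  `W`, EVERY cut is an `𝔽₂`-polynomial of degree `≤ ⌊√(n − |W|)⌋` in the free coordinates, then `#WIN ≤ θ·2ⁿ` (ONE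
  `θ < 1`, every `n`).  Proof: the tree's sub-cube tube bound `Subcube.card_win_ext_le` (`AffBells22WalkHardAllSubcube`,
  from `failSet_ge_of_mem_fullSpan`) per assignment, averaged by `sum_card_merge`.  The tree's `walkHardAllSubcube` is
  the special case `|W| ≤ δ₀ n`, one assignment, polylog degree;
* `pinFloor` — the least floor from which the law holds (`Nat.find`); `PinTame` / `Pinnable` — the dial; `win_le_of_pinnable`;
* **`localityLaw`** — REACH dial up to LINEAR reach: `ℓ`-window-local strategies with `m₁·ℓ ≤ n` win on `≤ θ·2ⁿ` inputs
  (tree: reach `(log₂ n)^C`, `windowLocalHardU`), via `pinnable_of_windowLocal` (pin all but `pinFloor + 1` coordinates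
  spaced `2ℓ` apart; each cut reads `≤ 1` free coordinate);
* **`juntaLaw_of_hitting`** — JUNTA-SIZE dial up to `η·n / log₂ n` (`JuntaLawLinear`) CONDITIONALLY on the pure
  hitting-set statement `SparseHittingSet` (tree: `(log₂ n)^C`, `walkHardFJuntaCuts`; tube: `⌊√n⌋`).

Nothing here proves the QuantumAdvantage summit; rung currency only.
-/

set_option linter.dupNamespace false
set_option autoImplicit false

noncomputable section

namespace Summit.QuantumAdvantage.QuantumAdvantage.Theorems.PinDial

open Finset Classical
open Summit.QuantumAdvantage.AdviceFreeQNC0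
open Summit.QuantumAdvantage.AdviceFreeQNC0.AffBells22
open Summit.QuantumAdvantage.AdviceFreeQNC0.Subcube

variable {n : ℕ}

/-! ## §1 Double counting over the assignments of the pinned set -/

/-- The SWAP bijection of the double cube: exchange the `W`-parts of the two points. -/
def swapW (W : Finset (Fin n)) : ((Fin n → Bool) × (Fin n → Bool)) ≃ ((Fin n → Bool) × (Fin n → Bool)) where
  toFun x := (subcubeMerge W x.1 x.2, subcubeMerge W x.2 x.1)
  invFun x := (subcubeMerge W x.1 x.2, subcubeMerge W x.2 x.1)
  left_inv x := by
    obtain ⟨a, u⟩ := x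
    refine Prod.ext ?_ ?_ <;> funext i <;> by_cases hi : i ∈ W <;> simp [subcubeMerge, hi]
  right_inv x := by
    obtain ⟨a, u⟩ := x
    refine Prod.ext ?_ ?_ <;> funext i <;> by_cases hi : i ∈ W <;> simp [subcubeMerge, hi]

/-- The first component of the swap is the merged point. -/
theorem swapW_fst (W : Finset (Fin n)) (x : (Fin n → Bool) × (Fin n → Bool)) :
    (swapW W x).1 = subcubeMerge W x.1 x.2 := rfl

/-- **Double counting**: summed over all assignments `a`, the number of `u` whose merged point `merge_W a u` has a
property is `2ⁿ` times the number of points with the property (each point `w` is `merge_W a u` for exactly `2ⁿ` pairs). -/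
theorem sum_card_merge (W : Finset (Fin n)) (P : (Fin n → Bool) → Prop) [DecidablePred P] :
    ∑ a : Fin n → Bool, (univ.filter fun u : Fin n → Bool => P (subcubeMerge W a u)).card
      = 2 ^ n * (univ.filter fun w : Fin n → Bool => P w).card := by
  have h1 : ∀ a : Fin n → Bool, (univ.filter fun u : Fin n → Bool => P (subcubeMerge W a u)).card
      = ∑ u : Fin n → Bool, if P (subcubeMerge W a u) then 1 else 0 := fun a => Finset.card_filter _ _
  have hcube : (univ : Finset (Fin n → Bool)).card = 2 ^ n := by
    rw [Finset.card_univ, Fintype.card_fun, Fintype.card_bool, Fintype.card_fin]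
  calc ∑ a : Fin n → Bool, (univ.filter fun u : Fin n → Bool => P (subcubeMerge W a u)).card
      = ∑ a : Fin n → Bool, ∑ u : Fin n → Bool, (if P (subcubeMerge W a u) then 1 else 0) :=
        Finset.sum_congr rfl fun a _ => h1 a
    _ = ∑ x : (Fin n → Bool) × (Fin n → Bool), (if P (subcubeMerge W x.1 x.2) then 1 else 0) :=
        (Fintype.sum_prod_type (fun x : (Fin n → Bool) × (Fin n → Bool) =>
          if P (subcubeMerge W x.1 x.2) then 1 else 0)).symm
    _ = ∑ x : (Fin n → Bool) × (Fin n → Bool),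
          (fun z : (Fin n → Bool) × (Fin n → Bool) => if P z.1 then 1 else 0) (swapW W x) :=
        Finset.sum_congr rfl fun x _ => rfl
    _ = ∑ z : (Fin n → Bool) × (Fin n → Bool), (if P z.1 then 1 else 0) :=
        Equiv.sum_comp (swapW W) (fun z : (Fin n → Bool) × (Fin n → Bool) => if P z.1 then 1 else 0)
    _ = ∑ w₁ : Fin n → Bool, ∑ _w₂ : Fin n → Bool, (if P w₁ then 1 else 0) :=
        Fintype.sum_prod_type (fun z : (Fin n → Bool) × (Fin n → Bool) => if P z.1 then 1 else 0)
    _ = ∑ w₁ : Fin n → Bool, 2 ^ n * (if P w₁ then 1 else 0) := by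
        refine Finset.sum_congr rfl fun w₁ _ => ?_
        rw [Finset.sum_const, hcube, smul_eq_mul]
    _ = 2 ^ n * ∑ w₁ : Fin n → Bool, (if P w₁ then 1 else 0) := by rw [Finset.mul_sum]
    _ = 2 ^ n * (univ.filter fun w : Fin n → Bool => P w).card := by rw [Finset.card_filter]

/-! ## §2 THE LAW: pinned square-root tube bound, averaged over assignments -/

/-- **`pinLaw`** (field-free; every `n`; ONE `θ < 1` and ONE `m₀`): if the coordinates outside `W` number at least
`m₀` and, under every assignment of the coordinates in `W`, every cut is an `𝔽₂`-polynomial of degree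
`≤ ⌊√(n − |W|)⌋` in the free coordinates, then the strategy wins α's u-walk game (`ringWinU c y`) on at most `θ·2ⁿ`
inputs. -/
theorem pinLaw : ∃ θ : ℝ, θ < 1 ∧ ∃ m₀ : ℕ, ∀ (n c : ℕ) (W : Finset (Fin n))
    (y : Fin (n + 1) → (Fin n → Bool) → Bool), m₀ ≤ n - W.card →
    (∀ (a : Fin n → Bool) (g : Fin (n + 1)), HasDeg (fun u => y g (subcubeMerge W a u)) (Nat.sqrt (n - W.card))) →
    ((univ.filter fun u : Fin n → Bool => ringWinU c y u = true).card : ℝ) ≤ θ * (2 : ℝ) ^ n := by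
  obtain ⟨c₀, hc₀, m₀, hcore⟩ := failSet_ge_of_mem_fullSpan
  refine ⟨1 - c₀, by linarith, m₀, fun n c W y hm hy => ?_⟩
  -- per assignment: the tube bound on the free cube, counted with multiplicity `2^{|W|}`
  have hper : ∀ a : Fin n → Bool,
      ((univ.filter fun u : Fin n → Bool => ringWinU c y (subcubeMerge W a u) = true).card : ℝ)
        ≤ (1 - c₀) * (2 : ℝ) ^ n := by
    intro a
    have h1 := card_filter_merge_le W a (fun u : Fin n → Bool => ringWinU c y u = true)
    have h2 := card_win_ext_le W a hcore hm le_rfl c y (hy a)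
    have hpow : (2 : ℝ) ^ W.card * (2 : ℝ) ^ (n - W.card) = (2 : ℝ) ^ n := by
      rw [← pow_add, card_add_sub W]
    have h1R : ((univ.filter fun u : Fin n → Bool => ringWinU c y (subcubeMerge W a u) = true).card : ℝ)
        ≤ (2 : ℝ) ^ W.card *
          ((univ.filter fun v : Fin (n - W.card) → Bool => ringWinU c y (ext W a v) = true).card : ℝ) := by
      exact_mod_cast h1
    calc ((univ.filter fun u : Fin n → Bool => ringWinU c y (subcubeMerge W a u) = true).card : ℝ)
        ≤ (2 : ℝ) ^ W.card *
          ((univ.filter fun v : Fin (n - W.card) → Bool => ringWinU c y (ext W a v) = true).card : ℝ) := h1R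
      _ ≤ (2 : ℝ) ^ W.card * ((1 - c₀) * (2 : ℝ) ^ (n - W.card)) :=
          mul_le_mul_of_nonneg_left h2 (by positivity)
      _ = (1 - c₀) * (2 : ℝ) ^ n := by rw [← hpow]; ring
  -- sum over the assignments and divide by `2ⁿ`
  have hsum := sum_card_merge W (fun u : Fin n → Bool => ringWinU c y u = true)
  have hsumR : ((2 : ℝ) ^ n) * ((univ.filter fun u : Fin n → Bool => ringWinU c y u = true).card : ℝ)
      = ∑ a : Fin n → Bool,
          ((univ.filter fun u : Fin n → Bool => ringWinU c y (subcubeMerge W a u) = true).card : ℝ) := by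
    exact_mod_cast hsum.symm
  have hle : ∑ a : Fin n → Bool,
      ((univ.filter fun u : Fin n → Bool => ringWinU c y (subcubeMerge W a u) = true).card : ℝ)
        ≤ ∑ _a : Fin n → Bool, (1 - c₀) * (2 : ℝ) ^ n := Finset.sum_le_sum fun a _ => hper a
  rw [Finset.sum_const, Finset.card_univ, Fintype.card_fun, Fintype.card_bool, Fintype.card_fin, nsmul_eq_mul] at hle
  push_cast at hle
  rw [← hsumR] at hle
  have h2n : (0 : ℝ) < (2 : ℝ) ^ n := by positivity
  nlinarith

/-- **`pinLaw_polylog`** — the polylog reading: all but `(log₂ n)^{2C+1}` coordinates may be pinned when the cuts are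
`𝔽₂`-polynomials of degree `(log₂ n)^C` in the free coordinates (ONE `θ < 1` for all `C`; `n ≥ n₀(C)`). -/
theorem pinLaw_polylog : ∃ θ : ℝ, θ < 1 ∧ ∀ C : ℕ, ∃ n₀ : ℕ, ∀ n ≥ n₀, ∀ (c : ℕ) (W : Finset (Fin n))
    (y : Fin (n + 1) → (Fin n → Bool) → Bool), (Nat.log 2 n) ^ (2 * C + 1) ≤ n - W.card →
    (∀ (a : Fin n → Bool) (g : Fin (n + 1)), HasDeg (fun u => y g (subcubeMerge W a u)) ((Nat.log 2 n) ^ C)) →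
    ((univ.filter fun u : Fin n → Bool => ringWinU c y u = true).card : ℝ) ≤ θ * (2 : ℝ) ^ n := by
  obtain ⟨θ, hθ, m₀, hlaw⟩ := pinLaw
  refine ⟨θ, hθ, fun C => ⟨2 ^ (m₀ + 1), fun n hn c W y hW hy => ?_⟩⟩
  have hlog : m₀ + 1 ≤ Nat.log 2 n := Nat.le_log_of_pow_le (by norm_num) hn
  have hℓ1 : 1 ≤ Nat.log 2 n := by omega
  have hpowle : Nat.log 2 n ≤ (Nat.log 2 n) ^ (2 * C + 1) := by
    calc Nat.log 2 n = (Nat.log 2 n) ^ 1 := (pow_one _).symm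
      _ ≤ (Nat.log 2 n) ^ (2 * C + 1) := Nat.pow_le_pow_right hℓ1 (by omega)
  have hm : m₀ ≤ n - W.card := by omega
  refine hlaw n c W y hm fun a g => ?_
  have hdeg : (Nat.log 2 n) ^ C ≤ Nat.sqrt (n - W.card) := by
    rw [Nat.le_sqrt]
    calc (Nat.log 2 n) ^ C * (Nat.log 2 n) ^ C = (Nat.log 2 n) ^ (2 * C) := by rw [← pow_add]; ring_nf
      _ ≤ (Nat.log 2 n) ^ (2 * C + 1) := Nat.pow_le_pow_right hℓ1 (by omega)
      _ ≤ n - W.card := hW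
  exact Literature.Computability.MetaComplexity.Smolensky.lowDeg_mono hdeg (hy a g)

/-! ## §3 The law's own floor `pinFloor` and the dial on item 23109: `Pinnable` / LOW / HIGH -/

/-- The pinned tube law from `m` free coordinates on. -/
def PinLawFrom (m : ℕ) : Prop :=
  ∃ θ : ℝ, θ < 1 ∧ ∀ (n c : ℕ) (W : Finset (Fin n)) (y : Fin (n + 1) → (Fin n → Bool) → Bool), m ≤ n - W.card →
    (∀ (a : Fin n → Bool) (g : Fin (n + 1)), HasDeg (fun u => y g (subcubeMerge W a u)) (Nat.sqrt (n - W.card))) →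
    ((univ.filter fun u : Fin n → Bool => ringWinU c y u = true).card : ℝ) ≤ θ * (2 : ℝ) ^ n

/-- The pinned tube law holds from some floor on (`pinLaw`). -/
theorem pinLawFrom_exists : ∃ m : ℕ, PinLawFrom m := by
  obtain ⟨θ, hθ, m₀, h⟩ := pinLaw
  exact ⟨m₀, θ, hθ, h⟩

/-- `pinFloor` := the LEAST number of free coordinates from which the pinned tube law holds (an absolute constant). -/
def pinFloor : ℕ := Nat.find pinLawFrom_exists

/-- The law at its own floor. -/
theorem pinLaw_floor : PinLawFrom pinFloor := Nat.find_spec pinLawFrom_exists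

/-- Minimality of the floor. -/
theorem pinFloor_le {m : ℕ} (h : PinLawFrom m) : pinFloor ≤ m := Nat.find_min' pinLawFrom_exists h

/-- `W` PINS `y` TAME: at least `pinFloor` free coordinates, and under every assignment of `W` every cut has
`𝔽₂`-degree `≤ ⌊√(n − |W|)⌋` in the free coordinates. -/
def PinTame (n : ℕ) (W : Finset (Fin n)) (y : Fin (n + 1) → (Fin n → Bool) → Bool) : Prop :=
  pinFloor ≤ n - W.card ∧
    ∀ (a : Fin n → Bool) (g : Fin (n + 1)), HasDeg (fun u => y g (subcubeMerge W a u)) (Nat.sqrt (n - W.card))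

/-- grade LOW of the pinned-`𝔽₂`-degree dial: some coordinate set pins the strategy tame. -/
def Pinnable (n : ℕ) (y : Fin (n + 1) → (Fin n → Bool) → Bool) : Prop := ∃ W : Finset (Fin n), PinTame n W y

/-- The law at its floor, in dial form: a pinnable strategy wins on at most `θ·2ⁿ` inputs (ONE `θ < 1`, every `n`). -/
theorem win_le_of_pinnable : ∃ θ : ℝ, θ < 1 ∧ ∀ (n c : ℕ) (y : Fin (n + 1) → (Fin n → Bool) → Bool),
    Pinnable n y → ((univ.filter fun u : Fin n → Bool => ringWinU c y u = true).card : ℝ) ≤ θ * (2 : ℝ) ^ n := by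
  obtain ⟨θ, hθ, hlaw⟩ := pinLaw_floor
  exact ⟨θ, hθ, fun n c y ⟨W, hfree, htame⟩ => hlaw n c W y hfree htame⟩

/-! ## §5 The REACH dial — `localityLaw` (members of LOW: window-local strategies of linear reach) -/

/-- The SPREAD free set for reach `ℓ ≥ 1`: the `m + 1` coordinates `0, 2ℓ, 4ℓ, …, 2mℓ` (everything else is pinned). -/
def spreadFree (n ℓ m : ℕ) (hℓ : 0 < ℓ) (h : ∀ k : Fin (m + 1), k.val * (2 * ℓ) < n) : Fin (m + 1) ↪ Fin n :=
  ⟨fun k => ⟨k.val * (2 * ℓ), h k⟩, fun k k' hkk' => by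
    have hv : k.val * (2 * ℓ) = k'.val * (2 * ℓ) := by
      have := congrArg Fin.val hkk'
      simpa using this
    exact Fin.ext (Nat.eq_of_mul_eq_mul_right (by omega) hv)⟩

/-- Two spread coordinates inside one window `[g − ℓ, g + ℓ)` coincide. -/
theorem spread_unique {ℓ m : ℕ} (g : ℕ) (k k' : Fin (m + 1)) (hk1 : g ≤ k.val * (2 * ℓ) + ℓ) (hk2 : k.val * (2 * ℓ) < g + ℓ)
    (hk'1 : g ≤ k'.val * (2 * ℓ) + ℓ) (hk'2 : k'.val * (2 * ℓ) < g + ℓ) : k = k' := by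
  have e1 : (k'.val + 1) * (2 * ℓ) = k'.val * (2 * ℓ) + 2 * ℓ := by ring
  have e2 : (k.val + 1) * (2 * ℓ) = k.val * (2 * ℓ) + 2 * ℓ := by ring
  have h1 : k.val < k'.val + 1 := by
    have : k.val * (2 * ℓ) < (k'.val + 1) * (2 * ℓ) := by omega
    exact Nat.lt_of_mul_lt_mul_right this
  have h2 : k'.val < k.val + 1 := by
    have : k'.val * (2 * ℓ) < (k.val + 1) * (2 * ℓ) := by omega
    exact Nat.lt_of_mul_lt_mul_right this
  exact Fin.ext (by omega)

/-- **`pinnable_of_windowLocal`** — every `ℓ`-WINDOW-LOCAL strategy (each cut reads only the bits within distance `ℓ`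
of it; ANY field, ANY complexity) with `2ℓ·(pinFloor + 1) ≤ n` is `Pinnable`: pin all coordinates except
`0, 2ℓ, …, 2ℓ·pinFloor`; each cut then reads at most ONE free coordinate, so it has `𝔽₂`-degree `≤ 1 ≤ √free` in the
free coordinates under every assignment (junta-degree lemma `ind_mem_lowDeg_of_dependsOn`, tree). -/
theorem pinnable_of_windowLocal {ℓ : ℕ} (hℓ : 0 < ℓ) (hn : 2 * ℓ * (pinFloor + 1) ≤ n)
    (y : Fin (n + 1) → (Fin n → Bool) → Bool) (hy : WindowLocal ℓ y) : Pinnable n y := by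
  have hlt : ∀ k : Fin (pinFloor + 1), k.val * (2 * ℓ) < n := by
    intro k
    have hk : k.val * (2 * ℓ) ≤ pinFloor * (2 * ℓ) := Nat.mul_le_mul_right _ (by omega)
    have e1 : 2 * ℓ * (pinFloor + 1) = pinFloor * (2 * ℓ) + 2 * ℓ := by ring
    omega
  have hpn : pinFloor + 1 ≤ n :=
    le_trans (Nat.le_mul_of_pos_left (pinFloor + 1) (by omega : 0 < 2 * ℓ)) hn
  set F : Finset (Fin n) := univ.map (spreadFree n ℓ pinFloor hℓ hlt) with hF
  have hFcard : F.card = pinFloor + 1 := by rw [hF, Finset.card_map, Finset.card_univ, Fintype.card_fin]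
  have hfree : n - Fᶜ.card = pinFloor + 1 := by
    rw [Finset.card_compl, Fintype.card_fin, hFcard]; omega
  refine ⟨Fᶜ, by rw [hfree]; omega, fun a g => ?_⟩
  · -- the free coordinates read by cut `g`
    set S : Finset (Fin n) := F.filter fun i => g.val ≤ i.val + ℓ ∧ i.val < g.val + ℓ with hS
    have hScard : S.card ≤ 1 := by
      refine Finset.card_le_one.mpr fun i hi i' hi' => ?_
      rw [hS, Finset.mem_filter, hF, Finset.mem_map] at hi hi'
      obtain ⟨⟨k, _, rfl⟩, hk1, hk2⟩ := hi
      obtain ⟨⟨k', _, rfl⟩, hk'1, hk'2⟩ := hi'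
      have := spread_unique g.val k k' hk1 hk2 hk'1 hk'2
      rw [this]
    have hdep : ∀ u v : Fin n → Bool, (∀ i ∈ S, u i = v i) →
        y g (subcubeMerge Fᶜ a u) = y g (subcubeMerge Fᶜ a v) := by
      intro u v huv
      refine hy g _ _ fun i h1 h2 => ?_
      by_cases hi : i ∈ Fᶜ
      · simp [subcubeMerge, hi]
      · have hiF : i ∈ F := by simpa [Finset.mem_compl] using hi
        have hiS : i ∈ S := by rw [hS, Finset.mem_filter]; exact ⟨hiF, h1, h2⟩
        simp [subcubeMerge, hi, huv i hiS]
    have hdeg1 : S.card ≤ Nat.sqrt (n - Fᶜ.card) := by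
      rw [hfree]
      exact le_trans hScard (Nat.le_sqrt.mpr (by nlinarith))
    unfold HasDeg
    exact Literature.Computability.MetaComplexity.Smolensky.lowDeg_mono hdeg1
      (ind_mem_lowDeg_of_dependsOn (F := ZMod 2) S _ hdep)

/-- **`localityLaw`** — the REACH dial priced up to LINEAR reach (field-free; every `n`; ONE `θ < 1`): an `ℓ`-window-local
strategy with `1 ≤ ℓ` and `m₁·ℓ ≤ n` wins α's u-walk game on at most `θ·2ⁿ` inputs.  (Tree: reach `(log₂ n)^C`,
`windowLocalHardU`.) -/
theorem localityLaw : ∃ θ : ℝ, θ < 1 ∧ ∃ m₁ : ℕ, ∀ (n ℓ c : ℕ) (y : Fin (n + 1) → (Fin n → Bool) → Bool),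
    1 ≤ ℓ → m₁ * ℓ ≤ n → WindowLocal ℓ y →
    ((univ.filter fun u : Fin n → Bool => ringWinU c y u = true).card : ℝ) ≤ θ * (2 : ℝ) ^ n := by
  obtain ⟨θ, hθ, hlaw⟩ := win_le_of_pinnable
  refine ⟨θ, hθ, 2 * (pinFloor + 1), fun n ℓ c y hℓ hn hy => hlaw n c y ?_⟩
  refine pinnable_of_windowLocal (by omega) ?_ y hy
  calc 2 * ℓ * (pinFloor + 1) = 2 * (pinFloor + 1) * ℓ := by ring
    _ ≤ n := hn

/-! ## §6 Members of LOW, II: the JUNTA-SIZE dial up to `η·n / log₂ n`, modulo a pure hitting-set statement -/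

/-- **`SparseHittingSet`** (pure combinatorics; leaf ATTACKABLE — a Chernoff / hypergeometric-tail computation with a
uniformly random `F` of size `≈ 4 (log₂ n)²`): `n + 1` sets of size `≤ r ≤ η·n / log₂ n` in `[n]` admit a set `F` of at
least `log₂ n` coordinates meeting each of them in at most `⌊√|F|⌋` points. -/
def SparseHittingSet : Prop :=
  ∃ η : ℝ, 0 < η ∧ ∃ n₀ : ℕ, ∀ n ≥ n₀, ∀ (r : ℕ) (J : Fin (n + 1) → Finset (Fin n)), (∀ g, (J g).card ≤ r) →
    (r : ℝ) * Nat.log 2 n ≤ η * n →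
    ∃ F : Finset (Fin n), Nat.log 2 n ≤ F.card ∧ ∀ g, (J g ∩ F).card ≤ Nat.sqrt F.card

/-- **`JuntaLawLinear`** — the junta-size dial at `r ≤ η·n / log₂ n` (field-free): a strategy whose every cut depends on
at most `r` input bits (anywhere) wins on at most `θ·2ⁿ` inputs.  (Tree: `r = (log₂ n)^C`, `walkHardFJuntaCuts`,
`p ≠ 3`; the tube: `r = ⌊√n⌋`.) -/
def JuntaLawLinear : Prop :=
  ∃ θ : ℝ, θ < 1 ∧ ∃ η : ℝ, 0 < η ∧ ∃ n₀ : ℕ, ∀ n ≥ n₀, ∀ (r c : ℕ) (y : Fin (n + 1) → (Fin n → Bool) → Bool)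
    (J : Fin (n + 1) → Finset (Fin n)), (∀ g, (J g).card ≤ r) →
    (∀ g, ∀ u v : Fin n → Bool, (∀ i ∈ J g, u i = v i) → y g u = y g v) →
    (r : ℝ) * Nat.log 2 n ≤ η * n →
    ((univ.filter fun u : Fin n → Bool => ringWinU c y u = true).card : ℝ) ≤ θ * (2 : ℝ) ^ n

/-- **`juntaLaw_of_hitting`**: the hitting set makes an `r`-junta strategy `Pinnable` (pin `Fᶜ`; cut `g` then depends on
`J g ∩ F`, of size `≤ √|F|`), so the law decides the junta-size dial up to `η·n / log₂ n`. -/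
theorem juntaLaw_of_hitting (hH : SparseHittingSet) : JuntaLawLinear := by
  obtain ⟨θ, hθ, hlaw⟩ := win_le_of_pinnable
  obtain ⟨η, hη, n₀, hhit⟩ := hH
  refine ⟨θ, hθ, η, hη, max n₀ (2 ^ pinFloor), fun n hn r c y J hJ hdepJ hr => hlaw n c y ?_⟩
  obtain ⟨F, hFcard, hF⟩ := hhit n (le_trans (le_max_left _ _) hn) r J hJ hr
  have hlog : pinFloor ≤ Nat.log 2 n := Nat.le_log_of_pow_le (by norm_num) (le_trans (le_max_right _ _) hn)
  have hfree : n - Fᶜ.card = F.card := by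
    rw [Finset.card_compl, Fintype.card_fin]
    have : F.card ≤ n := card_finset_fin_le F
    omega
  refine ⟨Fᶜ, by rw [hfree]; omega, fun a g => ?_⟩
  have hdep : ∀ u v : Fin n → Bool, (∀ i ∈ J g ∩ F, u i = v i) →
      y g (subcubeMerge Fᶜ a u) = y g (subcubeMerge Fᶜ a v) := by
    intro u v huv
    refine hdepJ g _ _ fun i hiJ => ?_
    by_cases hi : i ∈ Fᶜ
    · simp [subcubeMerge, hi]
    · have hiF : i ∈ F := by simpa [Finset.mem_compl] using hi
      simp [subcubeMerge, hi, huv i (Finset.mem_inter.mpr ⟨hiJ, hiF⟩)]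
  have hdeg : (J g ∩ F).card ≤ Nat.sqrt (n - Fᶜ.card) := by rw [hfree]; exact hF g
  unfold HasDeg
  exact Literature.Computability.MetaComplexity.Smolensky.lowDeg_mono hdeg
    (ind_mem_lowDeg_of_dependsOn (F := ZMod 2) (J g ∩ F) _ hdep)

end Summit.QuantumAdvantage.QuantumAdvantage.Theorems.PinDial
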